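import Summits.ValiantsHypothesis.ValiantsHypothesis.Theorems.DivisionGapZeroOneTransferStubFormulaGridProjection
import Summits.ValiantsHypothesis.ValiantsHypothesis.Theorems.DivisionGapZeroOneTransferProjClosure
import Literature.Computability.AlgebraicComplexity.ArithCircuitProofs
import Literature.Computability.AlgebraicComplexity.QuasiPolynomialFormulasProofs
import Literature.Computability.AlgebraicComplexity.DefinableVNPWitness
import Literature.Computability.AlgebraicComplexity.RealTauConjectureDepthFour

/-!
# Crux `ZeroOneTransfer` (stmt-ValiantsHypothesis-5066), line `planar-dimer-sign-elimination` —
converse normal form: a division certificate of quasi-polynomial size AND degree is ONE grid-dimer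
quotient, so the bet (S) follows from the crux with a cofactor-degree clause

* `formulaGridProjection_of_le` — the landed universality theorem (U) with the grid size PRESCRIBED
  (every even `N ≥ 6 s + 2`), so that several polynomials share one `N`.
* `gridQuotient_of_certificate` — `deg g, deg h < 2^E`, `#τ ≤ 2^E`, `L(g), L(h) ≤ 2^E`, `1 ≤ E` ⇒
  `g`, `h` are projections over `ℝ≥0` of the SAME `PM_{ℝ≥0}(N)`, `N ≤ 2^(18 E² + 3)` (semiring depth
  reduction `formulaComplexity_le_two_pow` + (U)); grid analogue of `stub_spanOfCertificate` (p96452).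
* `signElimination_of_degCertificate` — the registered bet `stub_signElimination` (S) follows from
  "every 0/1 family with a quasi-polynomial signed grid-dimer representation has a certificate
  `f_n · h = g` of quasi-polynomial size with `deg h` quasi-polynomial" (the crux on (S)'s hypothesis
  class plus the route's cofactor-degree clause, cf. item 15046), with `I = J = 1`.  With
  `signEliminationReduction` ((S) ⟹ crux) this sandwiches (S) exactly as S2 (`arborescence-span`) and
  `ForestQuotient` (`hidden-markov-intertwiner`) are sandwiched: all three r1 lines reduce the crux to
  itself in a normal form.  Plumbing: `deg f_n ≤ N²`, `#vars f_n ≤ N⁴` (projection of `PM_ℂ(N)` after the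
  injective map `ℝ≥0 → ℂ`); `h` is cut down to the variables of `f_n` by `x ↦ 1` elsewhere (a positive
  projection), then everything is renamed to that finite subtype, where `2^E = 2^(4A₁ + A₂ + 2)`.
Unconditional; axioms `propext`, `Classical.choice`, `Quot.sound`.
-/

open MvPolynomial Finset
open scoped BigOperators NNReal
open Literature.Computability.AlgebraicComplexity

-- `Summit.ValiantsHypothesis.ValiantsHypothesis.…`: mandated layout (Sub = Summit), intended.
set_option linter.dupNamespace false

namespace Summit.ValiantsHypothesis.ValiantsHypothesis.Theorems.DivisionGapZeroOneTransfer

namespace SignEliminationOfCertificate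

/-- `Adj⟦a, b⟧` (local notation): adjacency of the square grid on `ℕ × ℕ`. -/
local notation3 "Adj⟦" a ", " b "⟧" =>
  (Prod.fst a + 1 = Prod.fst b ∧ Prod.snd a = Prod.snd b) ∨
    (Prod.fst b + 1 = Prod.fst a ∧ Prod.snd a = Prod.snd b) ∨
    (Prod.fst a = Prod.fst b ∧ Prod.snd a + 1 = Prod.snd b) ∨
    (Prod.fst a = Prod.fst b ∧ Prod.snd b + 1 = Prod.snd a)

/-- `box⟦r, c, h, w⟧` (local notation): the `h × w` rectangle of cells with top-left cell `(r, c)`. -/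
local notation3 "box⟦" r ", " c ", " h ", " w "⟧" =>
  (Finset.Ico r (r + h) ×ˢ Finset.Ico c (c + w) : Finset (ℕ × ℕ))

section Prescribed

variable {R : Type} [CommSemiring R] {ι : Type}

/-- **(U) with the grid size prescribed.**  Over any commutative semiring, a polynomial `g` of formula
size `s = formulaComplexity g` is a Valiant projection of the `N × N` square-grid dimer polynomial for
EVERY even `N` with `6 s + 2 ≤ N`: take the grid gadget of a size-optimal formula
(`FormulaGridProjection.hasGad_eval`, height and width `≤ 6 s + 2`, both even) at the corner `(0,0)`
and fill the rest of the square with horizontal dominoes (`FormulaGridProjection.gad_fill`), then read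
the matching sum through the route's encoding (`msum_box_eq_routeSum`). [folklore] -/
theorem formulaGridProjection_of_le (g : MvPolynomial ι R) (N : ℕ) (hNe : Even N)
    (hle : 6 * formulaComplexity g + 2 ≤ N) :
    IsProjection g
      (∑ f ∈ (Finset.univ : Finset (Fin N × Fin N → Fin N × Fin N)).filter (fun f => ∀ v, f (f v) = v ∧ f v ≠ v ∧ (((v.1 : ℕ) + 1 = (f v).1 ∧ (v.2 : ℕ) = (f v).2) ∨ (((f v).1 : ℕ) + 1 = v.1 ∧ (v.2 : ℕ) = (f v).2) ∨ ((v.1 : ℕ) = (f v).1 ∧ (v.2 : ℕ) + 1 = (f v).2) ∨ ((v.1 : ℕ) = (f v).1 ∧ ((f v).2 : ℕ) + 1 = v.2))), ∏ v : Fin N × Fin N, (MvPolynomial.X (v, f v) : MvPolynomial ((Fin N × Fin N) × (Fin N × Fin N)) R)) := by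
  obtain ⟨P, hF, h2, hC, hs⟩ := ArithCircuit.exists_computes_size_eq_formulaComplexity g
  obtain ⟨hh, ww, hhn, hwn, ehh, eww, -, -, H⟩ := FormulaGridProjection.hasGad_eval P hF h2
  obtain ⟨W, hlab, hsupp, hT⟩ := H 0 0
  obtain ⟨ph, hph⟩ := ehh
  obtain ⟨pw, hpw⟩ := eww
  obtain ⟨pn, hpn⟩ := hNe
  rw [← hs, show P.size = P.gates.length from rfl] at hle
  have hhN : hh ≤ N := by omega
  have hwN : ww ≤ N := by omega
  -- fill the `hh × ww` gadget up to the `N × N` square with horizontal dominoes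
  obtain ⟨τ, hτd⟩ : ∃ τ : ℕ × ℕ → ℕ × ℕ, ∀ v, τ v = if v.1 < hh
      then (v.1, if (v.2 + ww) % 2 = 0 then v.2 + 1 else v.2 - 1)
      else (v.1, if v.2 % 2 = 0 then v.2 + 1 else v.2 - 1) := ⟨_, fun v => rfl⟩
  have hτ : ∀ a ∈ box⟦0, 0, N, N⟧ \ box⟦0, 0, hh, ww⟧,
      τ a ∈ box⟦0, 0, N, N⟧ \ box⟦0, 0, hh, ww⟧ ∧ τ a ≠ a ∧ τ (τ a) = a ∧ Adj⟦a, τ a⟧ := by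
    intro a ha
    simp only [Finset.mem_sdiff, FormulaGridProjection.mem_box] at ha
    simp only [hτd]
    refine ⟨?_, ?_, ?_, ?_⟩
    · split_ifs <;>
      · simp only [Finset.mem_sdiff, FormulaGridProjection.mem_box]
        omega
    · intro h
      split_ifs at h <;>
      · have h1 := congrArg Prod.fst h
        have h2 := congrArg Prod.snd h
        dsimp only at h1 h2
        omega
    · split_ifs <;>
      · refine Prod.ext rfl ?_
        dsimp only
        omega
    · split_ifs <;> (dsimp only; omega)
  obtain ⟨W', hlab', hsupp', hT'⟩ := FormulaGridProjection.gad_fill (B := box⟦0, 0, N, N⟧) τ hlab hsupp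
    hT (fun v hv => by rw [FormulaGridProjection.mem_box] at hv ⊢; omega) hτ
  refine ⟨fun d => W' ((d.1.1 : ℕ), (d.1.2 : ℕ)) ((d.2.1 : ℕ), (d.2.2 : ℕ)), fun d => hlab' _ _, ?_⟩
  rw [map_sum]
  simp only [map_prod, MvPolynomial.aeval_X]
  rw [← FormulaGridProjection.msum_box_eq_routeSum N W' (fun a b h => (hsupp' a b h).2.2),
    hT'.2.2.2.2.1]
  exact hC.symm

end Prescribed

section Certificate

variable {τ : Type} [Fintype τ]

/-- **Grid quotient normal form of a division certificate.**  If `deg g, deg h < 2^E`, `#τ ≤ 2^E`,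
`L(g), L(h) ≤ 2^E` and `1 ≤ E`, then `g` and `h` are Valiant projections over `ℝ≥0` of the SAME
square-grid dimer polynomial `PM_{ℝ≥0}(N)`, `N ≤ 2^(18 E² + 3)`: semiring depth reduction
(`formulaComplexity_le_two_pow`: `E(g), E(h) ≤ 2^{18E²}`) and `formulaGridProjection_of_le` at the
common even size `N = 6 · 2^{18E²} + 2`.  (Grid analogue of `stub_spanOfCertificate`.)
[cite: BurgisserClausenShokrollahi1997, Thm. (21.35)–(21.36)] -/
theorem gridQuotient_of_certificate (g h : MvPolynomial τ ℝ≥0) (E : ℕ) (hE : 1 ≤ E)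
    (hdg : g.totalDegree < 2 ^ E) (hdh : h.totalDegree < 2 ^ E) (hcard : Fintype.card τ ≤ 2 ^ E)
    (hLg : complexity g ≤ 2 ^ E) (hLh : complexity h ≤ 2 ^ E) :
    ∃ N : ℕ, N ≤ 2 ^ (18 * E ^ 2 + 3) ∧
      IsProjection g
        (∑ f ∈ (Finset.univ : Finset (Fin N × Fin N → Fin N × Fin N)).filter (fun f => ∀ v, f (f v) = v ∧ f v ≠ v ∧ (((v.1 : ℕ) + 1 = (f v).1 ∧ (v.2 : ℕ) = (f v).2) ∨ (((f v).1 : ℕ) + 1 = v.1 ∧ (v.2 : ℕ) = (f v).2) ∨ ((v.1 : ℕ) = (f v).1 ∧ (v.2 : ℕ) + 1 = (f v).2) ∨ ((v.1 : ℕ) = (f v).1 ∧ ((f v).2 : ℕ) + 1 = v.2))), ∏ v : Fin N × Fin N, (MvPolynomial.X (v, f v) : MvPolynomial ((Fin N × Fin N) × (Fin N × Fin N)) ℝ≥0)) ∧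
      IsProjection h
        (∑ f ∈ (Finset.univ : Finset (Fin N × Fin N → Fin N × Fin N)).filter (fun f => ∀ v, f (f v) = v ∧ f v ≠ v ∧ (((v.1 : ℕ) + 1 = (f v).1 ∧ (v.2 : ℕ) = (f v).2) ∨ (((f v).1 : ℕ) + 1 = v.1 ∧ (v.2 : ℕ) = (f v).2) ∨ ((v.1 : ℕ) = (f v).1 ∧ (v.2 : ℕ) + 1 = (f v).2) ∨ ((v.1 : ℕ) = (f v).1 ∧ ((f v).2 : ℕ) + 1 = v.2))), ∏ v : Fin N × Fin N, (MvPolynomial.X (v, f v) : MvPolynomial ((Fin N × Fin N) × (Fin N × Fin N)) ℝ≥0)) := by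
  have hFg : formulaComplexity g ≤ 2 ^ (18 * E ^ 2) :=
    formulaComplexity_le_two_pow le_rfl hdg hcard hLg hE
  have hFh : formulaComplexity h ≤ 2 ^ (18 * E ^ 2) :=
    formulaComplexity_le_two_pow le_rfl hdh hcard hLh hE
  refine ⟨6 * 2 ^ (18 * E ^ 2) + 2, ?_, ?_, ?_⟩
  · have h1 : (1 : ℕ) ≤ 2 ^ (18 * E ^ 2) := Nat.one_le_two_pow
    calc 6 * 2 ^ (18 * E ^ 2) + 2 ≤ 8 * 2 ^ (18 * E ^ 2) := by omega
      _ = 2 ^ (18 * E ^ 2 + 3) := by rw [pow_add]; ring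
  · exact formulaGridProjection_of_le g _ ⟨3 * 2 ^ (18 * E ^ 2) + 1, by ring⟩ (by omega)
  · exact formulaGridProjection_of_le h _ ⟨3 * 2 ^ (18 * E ^ 2) + 1, by ring⟩ (by omega)

end Certificate

section Plumbing

/-- Injective renamings preserve the total degree (rename back along a left inverse; over an empty
variable type the polynomial is a constant). [folklore] -/
theorem totalDegree_rename_of_injective {σ σ' : Type} {e : σ' → σ} (he : Function.Injective e)
    (p : MvPolynomial σ' ℝ≥0) : (rename e p).totalDegree = p.totalDegree := by
  refine le_antisymm (totalDegree_rename_le e p) ?_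
  cases isEmpty_or_nonempty σ' with
  | inl h =>
    rw [eq_C_of_isEmpty p, totalDegree_C]
    exact Nat.zero_le _
  | inr h =>
    obtain ⟨r, hr⟩ := he.hasLeftInverse
    calc p.totalDegree = (rename r (rename e p)).totalDegree := by
          rw [rename_rename, hr.comp_eq_id, rename_id_apply]
      _ ≤ (rename e p).totalDegree := totalDegree_rename_le r _

/-- Renaming a projection gives a projection (twin of `DefVNP.IsProjection.rename'`, re-proved to
keep the imports light). [cite: Burgisser2000, Def. 2.6(1)] -/
theorem isProjection_rename {k : Type} [CommSemiring k] {σ τ τ' : Type} {g : MvPolynomial τ k}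
    {f : MvPolynomial σ k} (h : IsProjection g f) (φ : τ → τ') : IsProjection (rename φ g) f := by
  obtain ⟨a, ha, rfl⟩ := h
  refine ⟨fun i => rename φ (a i), fun i => ?_, ?_⟩
  · rcases ha i with ⟨j, hj⟩ | ⟨c, hc⟩
    · left; exact ⟨φ j, by show rename φ (a i) = _; rw [hj, rename_X]⟩
    · right; exact ⟨c, by show rename φ (a i) = _; rw [hc, rename_C]⟩
  · rw [← AlgHom.comp_apply]
    congr 1
    apply MvPolynomial.algHom_ext
    intro i
    simp

/-- The total degree is unchanged under the injective coefficient map `ℝ≥0 → ℂ`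
(`PerMultiplesHardNegative.toC_injective` in the tree; the one-line term is inlined). [folklore] -/
theorem totalDegree_map_coe {σ : Type} (p : MvPolynomial σ ℝ≥0) :
    (MvPolynomial.map (Complex.ofRealHom.comp NNReal.toRealHom) p).totalDegree = p.totalDegree := by
  rw [totalDegree, totalDegree,
    support_map_of_injective p (show Function.Injective (Complex.ofRealHom.comp NNReal.toRealHom) from
        Complex.ofReal_injective.comp NNReal.coe_injective)]

/-- The square-grid dimer polynomial of the `N × N` square has total degree `≤ N²` (every monomial is
a product of `N²` dart variables). [folklore] -/
theorem totalDegree_gridPM_le (R : Type) [CommSemiring R] [Nontrivial R] (N : ℕ) :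
    MvPolynomial.totalDegree
      (∑ f ∈ (Finset.univ : Finset (Fin N × Fin N → Fin N × Fin N)).filter (fun f => ∀ v, f (f v) = v ∧ f v ≠ v ∧ (((v.1 : ℕ) + 1 = (f v).1 ∧ (v.2 : ℕ) = (f v).2) ∨ (((f v).1 : ℕ) + 1 = v.1 ∧ (v.2 : ℕ) = (f v).2) ∨ ((v.1 : ℕ) = (f v).1 ∧ (v.2 : ℕ) + 1 = (f v).2) ∨ ((v.1 : ℕ) = (f v).1 ∧ ((f v).2 : ℕ) + 1 = v.2))), ∏ v : Fin N × Fin N, (MvPolynomial.X (v, f v) : MvPolynomial ((Fin N × Fin N) × (Fin N × Fin N)) R)) ≤ N ^ 2 := by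
  refine (totalDegree_finsetSum _ _).trans (Finset.sup_le fun f _ => ?_)
  refine (totalDegree_finsetProd _ _).trans (le_of_eq ?_)
  calc ∑ v : Fin N × Fin N, (X (v, f v) : MvPolynomial ((Fin N × Fin N) × (Fin N × Fin N)) R).totalDegree
      = ∑ _v : Fin N × Fin N, 1 := Finset.sum_congr rfl fun v _ => totalDegree_X (R := R) _
    _ = N ^ 2 := by simp [sq]

/-- A projection along labels `a` (each a variable or a constant) of a polynomial in the variables
`D` involves at most `#D` variables. [folklore] -/
theorem card_vars_aeval_le {σ : Type} [DecidableEq σ] {D : Type} [Fintype D] [DecidableEq D]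
    (a : D → MvPolynomial σ ℂ) (ha : ∀ d, (∃ j, a d = X j) ∨ ∃ c, a d = C c) (p : MvPolynomial D ℂ) :
    (aeval a p).vars.card ≤ Fintype.card D := by
  have hsub : (aeval a p).vars ⊆ Finset.univ.biUnion fun d => (a d).vars := by
    rw [aeval_eq_bind₁]
    exact (vars_bind₁ a p).trans (Finset.biUnion_subset_biUnion_of_subset_left _ (Finset.subset_univ _))
  refine (Finset.card_le_card hsub).trans (Finset.card_biUnion_le.trans ?_)
  calc ∑ d, (a d).vars.card ≤ ∑ _d : D, 1 := Finset.sum_le_sum fun d _ => ?_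
    _ = Fintype.card D := by simp
  rcases ha d with ⟨j, hj⟩ | ⟨c, hc⟩
  · rw [hj, vars_X, Finset.card_singleton]
  · rw [hc, vars_C]; exact Nat.zero_le _

/-- Arithmetic: one quasi-polynomial exponent absorbs the post-processing,
`18 (4 (ℓ+c₁)^{c₁} + (ℓ+c₂)^{c₂} + 2)² + 3 ≤ (ℓ + C)^C` with `C = 12 (c₁ + c₂ + 2)`. [folklore] -/
theorem absorb (c₁ c₂ : ℕ) : ∃ C : ℕ, ∀ ℓ : ℕ,
    18 * (4 * (ℓ + c₁) ^ c₁ + (ℓ + c₂) ^ c₂ + 2) ^ 2 + 3 ≤ (ℓ + C) ^ C := by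
  refine ⟨12 * (c₁ + c₂ + 2), fun ℓ => ?_⟩
  have hc1 : c₁ ≤ c₁ + c₂ + 2 := by omega
  have hc2 : c₂ ≤ c₁ + c₂ + 2 := by omega
  generalize hc : c₁ + c₂ + 2 = c at hc1 hc2
  have hcpos : 1 ≤ c := by omega
  have h1 : (ℓ + c₁) ^ c₁ ≤ (ℓ + c) ^ c :=
    calc (ℓ + c₁) ^ c₁ ≤ (ℓ + c) ^ c₁ := Nat.pow_le_pow_left (by omega) _
      _ ≤ (ℓ + c) ^ c := Nat.pow_le_pow_right (by omega) hc1
  have h2 : (ℓ + c₂) ^ c₂ ≤ (ℓ + c) ^ c :=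
    calc (ℓ + c₂) ^ c₂ ≤ (ℓ + c) ^ c₂ := Nat.pow_le_pow_left (by omega) _
      _ ≤ (ℓ + c) ^ c := Nat.pow_le_pow_right (by omega) hc2
  have hX2' : 2 ≤ (ℓ + c) ^ c :=
    calc 2 ≤ ℓ + c := by omega
      _ = (ℓ + c) ^ 1 := (pow_one _).symm
      _ ≤ (ℓ + c) ^ c := Nat.pow_le_pow_right (by omega) hcpos
  generalize hX : (ℓ + c) ^ c = X at h1 h2 hX2'
  have hinner : 4 * (ℓ + c₁) ^ c₁ + (ℓ + c₂) ^ c₂ + 2 ≤ 6 * X := by omega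
  have hsq : (4 * (ℓ + c₁) ^ c₁ + (ℓ + c₂) ^ c₂ + 2) ^ 2 ≤ (6 * X) ^ 2 := Nat.pow_le_pow_left hinner 2
  have hX10 : 1024 ≤ X ^ 10 :=
    calc 1024 = 2 ^ 10 := by norm_num
      _ ≤ X ^ 10 := Nat.pow_le_pow_left hX2' 10
  have hXX : 4 ≤ X ^ 2 := by nlinarith
  calc 18 * (4 * (ℓ + c₁) ^ c₁ + (ℓ + c₂) ^ c₂ + 2) ^ 2 + 3
      ≤ 18 * (6 * X) ^ 2 + 3 := by omega
    _ = 648 * X ^ 2 + 3 := by ring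
    _ ≤ 649 * X ^ 2 := by omega
    _ ≤ X ^ 10 * X ^ 2 := Nat.mul_le_mul_right _ (by omega)
    _ = X ^ 12 := by rw [← pow_add]
    _ = (ℓ + c) ^ (12 * c) := by rw [← hX, ← pow_mul, Nat.mul_comm]
    _ ≤ (ℓ + 12 * c) ^ (12 * c) := Nat.pow_le_pow_left (by omega) _

end Plumbing

end SignEliminationOfCertificate

open SignEliminationOfCertificate in
/-- **The bet (S) of line `planar-dimer-sign-elimination` follows from the crux with a cofactor-degree
clause, transported to (S)'s hypothesis class** (registered reduction, crux
stmt-ValiantsHypothesis-5066).  Hypothesis `H`: every `0/1`-coefficient family over `ℝ≥0` whose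
complexification is a `2^((log₂ n + c)^c)`-projection over `ℂ` of the square-grid dimer polynomial
admits nonzero cofactors `h` of quasi-polynomial DEGREE with `L(f_n · h) + L(h)` quasi-polynomial.
Conclusion: verbatim the registered stub `stub_signElimination`, with `I = J = 1`, `m₀ = h` (cut down
to the variables of `f_n`), `g₀ = f_n · h`, both projections of one `PM_{ℝ≥0}(N')`, `N'`
quasi-polynomial (`gridQuotient_of_certificate` on the finite subtype of the `≤ N⁴` variables of
`f_n`, with `2^E = 2^(4A₁ + A₂ + 2)`).  So (S) is the crux in grid-dimer normal form: it is implied by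
`ZeroOneTransfer` + quasi-polynomial cofactor degree (on its own, slightly larger, hypothesis class)
and implies `ZeroOneTransfer` (`signEliminationReduction`). [folklore] -/
theorem signElimination_of_degCertificate
    (H : ∀ (σ : ℕ → Type) [∀ n, Fintype (σ n)] (f : ∀ n, MvPolynomial (σ n) NNReal),
      (∀ n m, MvPolynomial.coeff m (f n) = 0 ∨ MvPolynomial.coeff m (f n) = 1) →
      (∃ c : ℕ, ∀ n : ℕ, ∃ N : ℕ, N ≤ 2 ^ ((Nat.log 2 n + c) ^ c) ∧
        IsProjection (MvPolynomial.map (Complex.ofRealHom.comp NNReal.toRealHom) (f n))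
          (∑ f ∈ (Finset.univ : Finset (Fin N × Fin N → Fin N × Fin N)).filter (fun f => ∀ v, f (f v) = v ∧ f v ≠ v ∧ (((v.1 : ℕ) + 1 = (f v).1 ∧ (v.2 : ℕ) = (f v).2) ∨ (((f v).1 : ℕ) + 1 = v.1 ∧ (v.2 : ℕ) = (f v).2) ∨ ((v.1 : ℕ) = (f v).1 ∧ (v.2 : ℕ) + 1 = (f v).2) ∨ ((v.1 : ℕ) = (f v).1 ∧ ((f v).2 : ℕ) + 1 = v.2))), ∏ v : Fin N × Fin N, (MvPolynomial.X (v, f v) : MvPolynomial ((Fin N × Fin N) × (Fin N × Fin N)) ℂ))) →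
      ∃ c : ℕ, ∀ n, ∃ h : MvPolynomial (σ n) NNReal, h ≠ 0 ∧
        h.totalDegree ≤ 2 ^ ((Nat.log 2 n + c) ^ c) ∧
        complexity (f n * h) + complexity h ≤ 2 ^ ((Nat.log 2 n + c) ^ c)) :
    ∀ (σ : ℕ → Type) [∀ n, Fintype (σ n)] (f : ∀ n, MvPolynomial (σ n) NNReal),
      (∀ n m, MvPolynomial.coeff m (f n) = 0 ∨ MvPolynomial.coeff m (f n) = 1) →
      (∃ c : ℕ, ∀ n : ℕ, ∃ N : ℕ, N ≤ 2 ^ ((Nat.log 2 n + c) ^ c) ∧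
        IsProjection (MvPolynomial.map (Complex.ofRealHom.comp NNReal.toRealHom) (f n))
          (∑ f ∈ (Finset.univ : Finset (Fin N × Fin N → Fin N × Fin N)).filter (fun f => ∀ v, f (f v) = v ∧ f v ≠ v ∧ (((v.1 : ℕ) + 1 = (f v).1 ∧ (v.2 : ℕ) = (f v).2) ∨ (((f v).1 : ℕ) + 1 = v.1 ∧ (v.2 : ℕ) = (f v).2) ∨ ((v.1 : ℕ) = (f v).1 ∧ (v.2 : ℕ) + 1 = (f v).2) ∨ ((v.1 : ℕ) = (f v).1 ∧ ((f v).2 : ℕ) + 1 = v.2))), ∏ v : Fin N × Fin N, (MvPolynomial.X (v, f v) : MvPolynomial ((Fin N × Fin N) × (Fin N × Fin N)) ℂ))) →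
      ∃ c : ℕ, ∀ n : ℕ, ∃ N I J : ℕ, N ≤ 2 ^ ((Nat.log 2 n + c) ^ c) ∧ I ≤ 2 ^ ((Nat.log 2 n + c) ^ c) ∧
        J ≤ 2 ^ ((Nat.log 2 n + c) ^ c) ∧
        ∃ (m : Fin I → MvPolynomial (σ n) NNReal) (g : Fin J → MvPolynomial (σ n) NNReal),
          (∀ i, IsProjection (m i)
            (∑ f ∈ (Finset.univ : Finset (Fin N × Fin N → Fin N × Fin N)).filter (fun f => ∀ v, f (f v) = v ∧ f v ≠ v ∧ (((v.1 : ℕ) + 1 = (f v).1 ∧ (v.2 : ℕ) = (f v).2) ∨ (((f v).1 : ℕ) + 1 = v.1 ∧ (v.2 : ℕ) = (f v).2) ∨ ((v.1 : ℕ) = (f v).1 ∧ (v.2 : ℕ) + 1 = (f v).2) ∨ ((v.1 : ℕ) = (f v).1 ∧ ((f v).2 : ℕ) + 1 = v.2))), ∏ v : Fin N × Fin N, (MvPolynomial.X (v, f v) : MvPolynomial ((Fin N × Fin N) × (Fin N × Fin N)) NNReal))) ∧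
          (∀ j, IsProjection (g j)
            (∑ f ∈ (Finset.univ : Finset (Fin N × Fin N → Fin N × Fin N)).filter (fun f => ∀ v, f (f v) = v ∧ f v ≠ v ∧ (((v.1 : ℕ) + 1 = (f v).1 ∧ (v.2 : ℕ) = (f v).2) ∨ (((f v).1 : ℕ) + 1 = v.1 ∧ (v.2 : ℕ) = (f v).2) ∨ ((v.1 : ℕ) = (f v).1 ∧ (v.2 : ℕ) + 1 = (f v).2) ∨ ((v.1 : ℕ) = (f v).1 ∧ ((f v).2 : ℕ) + 1 = v.2))), ∏ v : Fin N × Fin N, (MvPolynomial.X (v, f v) : MvPolynomial ((Fin N × Fin N) × (Fin N × Fin N)) NNReal))) ∧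
          (∑ i, m i) ≠ 0 ∧ f n * ∑ i, m i = ∑ j, g j := by
  intro σ _ f h01 hU
  obtain ⟨c₁, hc₁⟩ := hU
  obtain ⟨c₂, hc₂⟩ := H σ f h01 ⟨c₁, hc₁⟩
  obtain ⟨K, hK⟩ := absorb c₁ c₂
  refine ⟨K, fun n => ?_⟩
  classical
  obtain ⟨N, hN, hproj⟩ := hc₁ n
  obtain ⟨h, hne, hdeg, hL⟩ := hc₂ n
  set A₁ := (Nat.log 2 n + c₁) ^ c₁ with hA₁
  set A₂ := (Nat.log 2 n + c₂) ^ c₂ with hA₂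
  -- Step A: degree and number of variables of `f n`
  have hdegf : (f n).totalDegree ≤ N ^ 2 := by
    rw [← totalDegree_map_coe (f n)]
    exact (DefVNP.IsProjection.totalDegree_le_holds hproj).trans (totalDegree_gridPM_le ℂ N)
  have hvars : Fintype.card ((f n).vars) ≤ N ^ 4 := by
    obtain ⟨a, ha, hfa⟩ := hproj
    rw [Fintype.card_coe, ← vars_map_of_injective (p := f n)
      (show Function.Injective (Complex.ofRealHom.comp NNReal.toRealHom) from
        Complex.ofReal_injective.comp NNReal.coe_injective), hfa]
    refine (card_vars_aeval_le a ha _).trans (le_of_eq ?_)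
    simp only [Fintype.card_prod, Fintype.card_fin]
    ring
  -- Step B: cut the cofactor down to the variables of `f n`
  set V : Finset (σ n) := (f n).vars with hV
  set s : σ n → MvPolynomial (σ n) ℝ≥0 := fun i => if i ∈ V then X i else 1 with hs
  have hspos : ∀ i, (∃ j, s i = X j) ∨ ∃ c : ℝ≥0, c ≠ 0 ∧ s i = C c := fun i => by
    by_cases hi : i ∈ V
    · exact Or.inl ⟨i, if_pos hi⟩
    · exact Or.inr ⟨1, one_ne_zero, by rw [hs]; dsimp only; rw [if_neg hi, C_1]⟩
  have hslab : ∀ i, (∃ j, s i = X j) ∨ ∃ c, s i = C c := fun i =>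
    (hspos i).imp_right fun ⟨c, _, hc⟩ => ⟨c, hc⟩
  set h₁ : MvPolynomial (σ n) ℝ≥0 := aeval s h with hh₁
  have h₁ne : h₁ ≠ 0 := ProjClosure.aeval_ne_zero_of_pos' s hspos hne
  have hproj₁ : IsProjection h₁ h := ⟨s, hslab, rfl⟩
  have hfix : aeval s (f n) = f n := by
    have key := hom_congr_vars (f₁ := (aeval s : MvPolynomial (σ n) ℝ≥0 →ₐ[ℝ≥0] _).toRingHom)
      (f₂ := RingHom.id _) (p₁ := f n) (p₂ := f n) ?_ ?_ rfl
    · simpa using key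
    · ext r
      simp
    · intro i hi _
      have hi' : i ∈ V := hi
      simp [hs, hi']
  have hproj₂ : IsProjection (f n * h₁) (f n * h) := ⟨s, hslab, by rw [map_mul, hfix]⟩
  have hLh₁ : complexity h₁ ≤ complexity h := IsProjection.complexity_le_holds hproj₁
  have hLfh₁ : complexity (f n * h₁) ≤ complexity (f n * h) := IsProjection.complexity_le_holds hproj₂
  have hdegh₁ : h₁.totalDegree ≤ h.totalDegree := DefVNP.IsProjection.totalDegree_le_holds hproj₁
  have hvars₁ : h₁.vars ⊆ V := by
    have e1 : h₁ = bind₁ s h := by rw [hh₁, aeval_eq_bind₁]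
    rw [e1]
    refine (vars_bind₁ s h).trans (Finset.biUnion_subset.mpr fun i _ => ?_)
    by_cases hi : i ∈ V
    · have : s i = X i := if_pos hi
      rw [this, vars_X]
      exact Finset.singleton_subset_iff.mpr hi
    · have : s i = 1 := if_neg hi
      rw [this, vars_one]
      exact Finset.empty_subset _
  -- Step C: rename to the finite subtype of the variables of `f n`
  have hrange : ∀ p : MvPolynomial (σ n) ℝ≥0, p.vars ⊆ V →
      (↑p.vars : Set (σ n)) ⊆ Set.range (Subtype.val : V → σ n) := by
    intro p hp i hi
    exact ⟨⟨i, hp (Finset.mem_coe.mp hi)⟩, rfl⟩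
  obtain ⟨f', hf'⟩ := exists_rename_eq_of_vars_subset_range (f n) (Subtype.val : V → σ n) Subtype.val_injective
    (hrange _ subset_rfl)
  obtain ⟨h', hh'⟩ := exists_rename_eq_of_vars_subset_range h₁ (Subtype.val : V → σ n) Subtype.val_injective
    (hrange _ hvars₁)
  have h'ne : h' ≠ 0 := by
    rintro rfl
    exact h₁ne (by rw [← hh', map_zero])
  have hprod : rename (Subtype.val : V → σ n) (f' * h') = f n * h₁ := by rw [map_mul, hf', hh']
  have hLh' : complexity h' ≤ 2 ^ A₂ := by
    rw [← complexity_rename_of_injective_holds Subtype.val_injective h', hh']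
    exact hLh₁.trans ((Nat.le_add_left _ _).trans hL)
  have hLg' : complexity (f' * h') ≤ 2 ^ A₂ := by
    rw [← complexity_rename_of_injective_holds Subtype.val_injective (f' * h'), hprod]
    exact hLfh₁.trans ((Nat.le_add_right _ _).trans hL)
  have hdh' : h'.totalDegree ≤ 2 ^ A₂ := by
    rw [← totalDegree_rename_of_injective Subtype.val_injective h', hh']
    exact hdegh₁.trans hdeg
  have hdf' : f'.totalDegree ≤ N ^ 2 := by
    rw [← totalDegree_rename_of_injective Subtype.val_injective f', hf']
    exact hdegf
  have hdg' : (f' * h').totalDegree ≤ N ^ 2 + 2 ^ A₂ :=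
    (totalDegree_mul _ _).trans (add_le_add hdf' hdh')
  -- Step D: the budget `2^E`, `E = 4 A₁ + A₂ + 2`
  set E := 4 * A₁ + A₂ + 2 with hEdef
  have hN4 : N ^ 4 ≤ 2 ^ (4 * A₁) := by
    calc N ^ 4 ≤ (2 ^ A₁) ^ 4 := Nat.pow_le_pow_left hN 4
      _ = 2 ^ (4 * A₁) := by rw [← pow_mul, Nat.mul_comm]
  have hN2 : N ^ 2 ≤ 2 ^ (4 * A₁) :=
    calc N ^ 2 ≤ (2 ^ A₁) ^ 2 := Nat.pow_le_pow_left hN 2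
      _ ≤ (2 ^ A₁) ^ 4 := Nat.pow_le_pow_right Nat.one_le_two_pow (by norm_num)
      _ = 2 ^ (4 * A₁) := by rw [← pow_mul, Nat.mul_comm]
  have hpowE : 2 ^ (4 * A₁) + 2 ^ A₂ < 2 ^ E := by
    have e1 : 2 ^ (4 * A₁) ≤ 2 ^ (4 * A₁ + A₂) := Nat.pow_le_pow_right (by norm_num) (by omega)
    have e2 : 2 ^ A₂ ≤ 2 ^ (4 * A₁ + A₂) := Nat.pow_le_pow_right (by norm_num) (by omega)
    have e3 : 2 ^ E = 2 * 2 ^ (4 * A₁ + A₂) * 2 := by rw [hEdef, pow_add, pow_succ, pow_one]; ring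
    have e4 : 1 ≤ 2 ^ (4 * A₁ + A₂) := Nat.one_le_two_pow
    omega
  obtain ⟨N', hN', hpg, hph⟩ := gridQuotient_of_certificate (f' * h') h' E (by omega) (by omega)
    (by omega) (by omega) (by omega) (by omega)
  -- Step E: assemble (S) with `I = J = 1`
  have hbound : N' ≤ 2 ^ ((Nat.log 2 n + K) ^ K) :=
    hN'.trans (Nat.pow_le_pow_right (by norm_num) (by
      have := hK (Nat.log 2 n)
      rw [hEdef, hA₁, hA₂]
      exact this))
  refine ⟨N', 1, 1, hbound, Nat.one_le_two_pow, Nat.one_le_two_pow, fun _ => h₁, fun _ => f n * h₁,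
    fun _ => ?_, fun _ => ?_, ?_, ?_⟩
  · rw [← hh']
    exact isProjection_rename hph _
  · rw [← hprod]
    exact isProjection_rename hpg _
  · rw [Fin.sum_univ_one]
    exact h₁ne
  · rw [Fin.sum_univ_one, Fin.sum_univ_one]

end Summit.ValiantsHypothesis.ValiantsHypothesis.Theorems.DivisionGapZeroOneTransfer
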